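import Summits.AtomisticToContinuum.HydrodynamicLimit.Theorems.InformationPercolationEnginePercolationClosesChaosForecastStatements
import Literature.MathematicalPhysics.KineticTheory.MollifiedPoolPairField
import HarnessLib

/-!
# Docking S7 of the line `equilibrium-forecast-chain-rule` (crux `InformationPercolationEngine.PercolationClosesChaos`,
stmt-AtomisticToContinuum-15178) — piece A: the target's defect as a collision pair sum along the flow

Support file (`--supports stmt-AtomisticToContinuum-15178`) of the registered stub
`stub_docking : KineticCellChaosLG → NoMesoscopicOscillation → LocalCountUI → ContactChaos` (worker S7 of lead c1).
The route target `ContactChaos` (Theses/InformationPercolationEngine.lean) states its event through a ten-line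
`let`-block (`ε, G, γ, bx, bt, Θ, Pm, Kc, pv, D`). This file names the zeta-expanded defect once and for all:

* `dockSummand χ Ψ r τ σ N Φ z s w i j = χ(s, x_i) Ψ(markOf w i j) Pm₁(z, s, x_i) − χ(s, x_i) Pm_Ψ(z, s, x_i)` with the
  line's `targetPm` (= the target's `Pm (Θ Ξ)`, and = `poolPairField` of the Literature by `targetPm_eq_poolPairField`);
* `dockDefect χ Ψ r τ σ N Φ z = ε_N/(N+1) · Φ.collisionPairSum (Icc 0 τ) (dockSummand …) z`;
* `dockDefect_eq`: on the good set the target's `D z` (written out verbatim) IS `dockDefect` — the finsum-over-collision-times /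
  double-sum-over-ordered-contact-pairs form of the target is `HardSphereFlow.collisionPairSum_eq_finsum_ite`, and the
  bodies agree definitionally (`bump`, `fluxAvg`, `markOf` unfold to the target's `bx`, `Θ`, `(ε⁻¹ sepVec, pv.1, pv.2)`);
* `measure_contactDefect_le` (registered helper): since the good set is `localGibbsLaw`-conull
  (`localGibbsLaw_compl_good_eq_zero`), a bound on `LG {z ∈ good | η < |dockDefect z|}` bounds the target's event
  `LG {η < |D z|}` — after the quantifier prefix of `ContactChaos` is introduced, `exact measure_contactDefect_le …` closes its
  `let`-goal by zeta-reduction (checked), so pieces B–H of the docking prove the target in `dockDefect` form.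

No mathematics beyond bookkeeping (Cercignani–Illner–Pulvirenti 1994 §4.2: collision sums along the flow are finite sums on
the good set).
-/

noncomputable section

open MeasureTheory Set Filter Topology
open scoped ENNReal BigOperators Classical
open Literature.Analysis.FluidPDE Literature.MathematicalPhysics.KineticTheory
open Literature.MathematicalPhysics.KineticTheory.VelocityBlindPlacement

namespace Summit.AtomisticToContinuum.HydrodynamicLimit.Theorems.EquilibriumForecastLine

/-- The TARGET'S COLLISION SUMMAND of an ordered contact pair `(i, j)` of the configuration `w` at time `s` along the
orbit of `z`: `χ(s, x_i) Ψ(ω, v_i⁻, v_j⁻) A_r(z; s, x_i) − χ(s, x_i) B^Ψ_r(z; s, x_i)` with `A_r = targetPm 1`,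
`B^Ψ_r = targetPm Ψ` (the `let`-bound `Pm (Θ 1)`, `Pm (Θ Ψ)` of `ContactChaos`, zeta-expanded). -/
def dockSummand (χ : ℝ × T3 → ℝ) (Ψ : V3 × V3 × V3 → ℝ) (r τ σ : ℝ) (N : ℕ) (Φ : Flow σ N)
    (z : Phase N) : ℝ → Phase N → Fin (N + 1) → Fin (N + 1) → ℝ := fun s w i j =>
  χ (s, (w i).1) * Ψ (markOf N (hsDiameter σ N) w i j) * targetPm (fun _ => 1) r τ σ N Φ z s (w i).1 -
    χ (s, (w i).1) * targetPm Ψ r τ σ N Φ z s (w i).1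

/-- The TARGET'S DEFECT FUNCTIONAL `D z = K_N[χ Ψ A_r](z) − K_N[χ B^Ψ_r](z)` written as ONE collision pair sum along the
flow: `ε_N/(N+1) · Σ_{collisions in [0,τ]} Σ_{ordered contact pairs} dockSummand`. -/
def dockDefect (χ : ℝ × T3 → ℝ) (Ψ : V3 × V3 × V3 → ℝ) (r τ σ : ℝ) (N : ℕ) (Φ : Flow σ N) (z : Phase N) : ℝ :=
  hsDiameter σ N / ((N : ℝ) + 1) * Φ.collisionPairSum (Icc 0 τ) (dockSummand χ Ψ r τ σ N Φ z) z

/-- Collision pair sums along the flow over a bounded window are additive under subtraction of the summands (good initial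
datum: finitely many collision times). [folklore] -/
theorem collisionPairSum_sub' {σ : ℝ} {N : ℕ} (Φ : Flow σ N) {z : Phase N} (hz : z ∈ Φ.good)
    {S : Set ℝ} {a b : ℝ} (hS : S ⊆ Icc a b) (g g' : ℝ → Phase N → Fin (N + 1) → Fin (N + 1) → ℝ) :
    Φ.collisionPairSum S (fun s w i j => g s w i j - g' s w i j) z =
      Φ.collisionPairSum S g z - Φ.collisionPairSum S g' z := by
  have hfin := Φ.finite_collisionTimes_inter hz hS
  unfold HardSphereFlow.collisionPairSum
  rw [Literature.Analysis.FluidPDE.collisionPairSum_eq_finset_sum hfin,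
    Literature.Analysis.FluidPDE.collisionPairSum_eq_finset_sum hfin,
    Literature.Analysis.FluidPDE.collisionPairSum_eq_finset_sum hfin, ← Finset.sum_sub_distrib]
  refine Finset.sum_congr rfl fun t _ => ?_
  rw [← Finset.sum_sub_distrib]

/-- **On the good set the target's defect is `dockDefect`.** The left-hand side is the `let`-block of `ContactChaos`
zeta-expanded verbatim (`Kc F₁ z − Kc F₂ z`); the finsum/double-sum form is `HardSphereFlow.collisionPairSum_eq_finsum_ite`,
and the summands agree definitionally. [folklore] -/
theorem dockDefect_eq {σ : ℝ} {N : ℕ} (Φ : Flow σ N) (χ : ℝ × T3 → ℝ) (Ψ : V3 × V3 × V3 → ℝ)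
    (r τ : ℝ) {z : Phase N} (hz : z ∈ Φ.good) :
    hsDiameter σ N / (N + 1 : ℝ) * (∑ᶠ (s : ℝ) (_ : s ∈ collisionTimes (Torus.geometry (Fin 3)) (hsDiameter σ N) (fun s => Φ.flow s z) ∩ Set.Icc 0 τ),
        ∑ i : Fin (N + 1), ∑ j : Fin (N + 1),
          (if i ≠ j ∧ ‖(Torus.geometry (Fin 3)).sepVec (Φ.flow s z i).1 (Φ.flow s z j).1‖ = hsDiameter σ N then
            χ (s, (Φ.flow s z i).1) *
              Ψ ((hsDiameter σ N)⁻¹ • (Torus.geometry (Fin 3)).sepVec (Φ.flow s z i).1 (Φ.flow s z j).1,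
                (reflectVel ((Torus.geometry (Fin 3)).sepVec (Φ.flow s z i).1 (Φ.flow s z j).1) ((Φ.flow s z i).2, (Φ.flow s z j).2)).1,
                (reflectVel ((Torus.geometry (Fin 3)).sepVec (Φ.flow s z i).1 (Φ.flow s z j).1) ((Φ.flow s z i).2, (Φ.flow s z j).2)).2) *
              (∫ s' in Set.Icc (0 : ℝ) τ, (r⁻¹ * max (1 - |s' - s| / r) 0) *
                ∫ p, (3 / (Real.pi * r ^ 3) * max (1 - Torus.euclidDist p.1.1 (Φ.flow s z i).1 / r) 0) *
                  (3 / (Real.pi * r ^ 3) * max (1 - Torus.euclidDist p.2.1 (Φ.flow s z i).1 / r) 0) *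
                  (∫ ω : Metric.sphere (0 : V3) 1, (fun _ => (1:ℝ)) ((ω : V3), p.1.2, p.2.2) * hardSphereKernel (p.2.2, p.1.2) ω ∂sphereMeasure)
                  ∂((empiricalMeasure (Φ.flow s' z)).prod (empiricalMeasure (Φ.flow s' z))))
          else 0)) -
      hsDiameter σ N / (N + 1 : ℝ) * (∑ᶠ (s : ℝ) (_ : s ∈ collisionTimes (Torus.geometry (Fin 3)) (hsDiameter σ N) (fun s => Φ.flow s z) ∩ Set.Icc 0 τ),
        ∑ i : Fin (N + 1), ∑ j : Fin (N + 1),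
          (if i ≠ j ∧ ‖(Torus.geometry (Fin 3)).sepVec (Φ.flow s z i).1 (Φ.flow s z j).1‖ = hsDiameter σ N then
            χ (s, (Φ.flow s z i).1) *
              (∫ s' in Set.Icc (0 : ℝ) τ, (r⁻¹ * max (1 - |s' - s| / r) 0) *
                ∫ p, (3 / (Real.pi * r ^ 3) * max (1 - Torus.euclidDist p.1.1 (Φ.flow s z i).1 / r) 0) *
                  (3 / (Real.pi * r ^ 3) * max (1 - Torus.euclidDist p.2.1 (Φ.flow s z i).1 / r) 0) *
                  (∫ ω : Metric.sphere (0 : V3) 1, Ψ ((ω : V3), p.1.2, p.2.2) * hardSphereKernel (p.2.2, p.1.2) ω ∂sphereMeasure)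
                  ∂((empiricalMeasure (Φ.flow s' z)).prod (empiricalMeasure (Φ.flow s' z))))
          else 0)) =
    dockDefect χ Ψ r τ σ N Φ z := by
  unfold dockDefect
  have hsub := collisionPairSum_sub' Φ hz (Subset.refl (Icc 0 τ))
    (fun s w i j => χ (s, (w i).1) * Ψ (markOf N (hsDiameter σ N) w i j) * targetPm (fun _ => 1) r τ σ N Φ z s (w i).1)
    (fun s w i j => χ (s, (w i).1) * targetPm Ψ r τ σ N Φ z s (w i).1)
  have hds : dockSummand χ Ψ r τ σ N Φ z = fun s w i j =>
      χ (s, (w i).1) * Ψ (markOf N (hsDiameter σ N) w i j) * targetPm (fun _ => 1) r τ σ N Φ z s (w i).1 -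
        χ (s, (w i).1) * targetPm Ψ r τ σ N Φ z s (w i).1 := rfl
  rw [hds, hsub, mul_sub, Φ.collisionPairSum_eq_finsum_ite hz, Φ.collisionPairSum_eq_finsum_ite hz]
  rfl

/-- **Registered helper `measure_contactDefect_le` (piece A of the docking S7): per-data docking.** The good set being
`localGibbsLaw`-conull, a bound on the good-set event of `dockDefect` is a bound on the target's event `{η < |D z|}` (the
`let`-block of `ContactChaos` zeta-expanded verbatim; any `δ : ℝ≥0∞`). [folklore] -/
theorem measure_contactDefect_le : ∀ {σ : ℝ} {N : ℕ} (Φ : Flow σ N) (a₀ θ₀ : T3 → ℝ) (u₀ : T3 → V3) (χ : ℝ × T3 → ℝ) (Ψ : V3 × V3 × V3 → ℝ) (r τ η : ℝ) (δ : ℝ≥0∞), localGibbsLaw σ a₀ u₀ θ₀ N Φ {z | z ∈ Φ.good ∧ η < |dockDefect χ Ψ r τ σ N Φ z|} ≤ δ → localGibbsLaw σ a₀ u₀ θ₀ N Φ {z | η < |hsDiameter σ N / (N + 1 : ℝ) * (∑ᶠ (s : ℝ) (_ : s ∈ collisionTimes (Torus.geometry (Fin 3)) (hsDiameter σ N) (fun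 s => Φ.flow s z) ∩ Set.Icc 0 τ), ∑ i : Fin (N + 1), ∑ j : Fin (N + 1), (if i ≠ j ∧ ‖(Torus.geometry (Fin 3)).sepVec (Φ.flow s z i).1 (Φ.flow s z j).1‖ = hsDiameter σ N then χ (s, (Φ.flow s z i).1) * Ψ ((hsDiameter σ N)⁻¹ • (Torus.geometry (Fin 3)).sepVec (Φ.flow s z i).1 (Φ.flow s z j).1, (reflectVel ((Torus.geometry (Fin 3)).sepVec (Φ.flow s z i).1 (Φ.flow s z j).1) ((Φ.flow s z i).2, (Φ.flow s z j).2)).1, (reflectVel ((Torus.geometry (Fin 3)).sepVec (Φ.flow s z i).1 (Φ.flow s z j).1) ((Φ.flow s z i).2, (Φ.flow s z j).2)).2) * (∫ s' in Set.Icc (0 : ℝ) τ, (r⁻¹ * max (1 - |s' - s| / r) 0) * ∫ p, (3 / (Real.pi * r ^ 3) * max (1 - Torus.euclidDist p.1.1 (Φ.flow s z i).1 / r) 0) * (3 / (Real.pi * r ^ 3) * max (1 - Torus.euclidDist p.2.1 (Φ.flow s z i).1 / r) 0) * (∫ ω : Metric.sphere (0 : V3) 1, (fun _ => (1:ℝ))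 ((ω : V3), p.1.2, p.2.2) * hardSphereKernel (p.2.2, p.1.2) ω ∂sphereMeasure) ∂((empiricalMeasure (Φ.flow s' z)).prod (empiricalMeasure (Φ.flow s' z)))) else 0)) - hsDiameter σ N / (N + 1 : ℝ) * (∑ᶠ (s : ℝ) (_ : s ∈ collisionTimes (Torus.geometry (Fin 3)) (hsDiameter σ N) (fun s => Φ.flow s z) ∩ Set.Icc 0 τ), ∑ i : Fin (N + 1), ∑ j : Fin (N + 1), (if i ≠ j ∧ ‖(Torus.geometry (Fin 3)).sepVec (Φ.flow s z i).1 (Φ.flow s z j).1‖ = hsDiameter σ N then χ (s, (Φ.flow s z i).1) * (∫ s' in Set.Icc (0 : ℝ) τ, (r⁻¹ * max (1 - |s' - s| / r) 0) * ∫ p, (3 / (Real.pi * r ^ 3) * max (1 - Torus.euclidDist p.1.1 (Φ.flow s z i).1 / r) 0) * (3 / (Real.pi * r ^ 3) * max (1 - Torus.euclidDist p.2.1 (Φ.flow s z i).1 / r) 0) * (∫ ω : Metric.sphere (0 : V3) 1, Ψ ((ω : V3), p.1.2, p.2.2) * hardSphereKernel (p.2.2, p.1.2) ω ∂sphereMeasure)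 ∂((empiricalMeasure (Φ.flow s' z)).prod (empiricalMeasure (Φ.flow s' z)))) else 0))|} ≤ δ := by
  intro σ N Φ a₀ θ₀ u₀ χ Ψ r τ η δ h
  have hgood : localGibbsLaw σ a₀ u₀ θ₀ N Φ Φ.goodᶜ = 0 := localGibbsLaw_compl_good_eq_zero Φ
  refine (measure_mono fun z hz => ?_).trans ((measure_union_le _ _).trans
    ((add_le_add h hgood.le).trans_eq (add_zero _)))
  by_cases hzg : z ∈ Φ.good
  · left
    refine ⟨hzg, ?_⟩
    rw [mem_setOf_eq, dockDefect_eq Φ χ Ψ r τ hzg] at hz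
    exact hz
  · right
    exact hzg

end Summit.AtomisticToContinuum.HydrodynamicLimit.Theorems.EquilibriumForecastLine

end
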